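import Summits.CriticalPhenomena.PercolationContinuityZ3.Theorems.PercAnnulusCrossingIICAspectTop
import Summits.CriticalPhenomena.PercolationContinuityZ3.Theorems.PercAnnulusCrossingObstacleQuasiMult
import Summits.CriticalPhenomena.PercolationContinuityZ3.Theorems.PercAnnulusCrossingIICDomination
import Summits.CriticalPhenomena.PercolationContinuityZ3.Theorems.PercAnnulusCrossingIICAspectExistence
import HarnessLib

/-!
# Lower domination of Kesten's IIC by arm-conditioned critical percolation (lane RSW3, p1 gen 8)

builds on p205010 (kernel theorem, internal audit signed; external expert review pending) — used only in the `p_c(ℤ^d)` corollaries of §3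
(through `θ(p_c) = 0`, `CSH.percolationContinuity_allDimensions`, to make the error term vanish); §1–§2 hold at every `p` and use nothing
beyond (A2)□.

RSW3 lane (LANE 3 `prim-rsw3`), seat `prim-rsw3-p1` (gen 8).  Helper file (`--supports stmt-CriticalPhenomena-4575`); no definitions, no sorries.
The LOWER companion of p1 gen 7's domination `ν ≤ C · P_p(· | 0 ↔ ∂ⁱⁿΛ(b))` on `σ(Λ(b))` (`…IICDomination`), item (ix) of the open list
P1-QM §19.19.  Write `A_N = {0 ↔ ∂ⁱⁿΛ(N)}`, `π(N) = P_p(A_N)`, `α(a,b) = P_p(boxCrossing d a b)`.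

* **`mul_real_inter_siteToBoundary_le_of_setToSetQuasiMultAspectAt`** (every `p`, (A2)□ at aspect `(s,L)`, `2 ≤ s < L`, `ϰ > 0`): for `E`
  determined inside `Λ(s m₁)`, `m₁ ≥ 1`, `L m₁ < s m₂`, `M = s(L m₂ + 2)` and every `n > L(L m₂ + 2)`:
  `ϰ · π(n) · (P(E ∩ A_M) − ϰ⁻² α(s m₁, s m₂) π(M)) ≤ P(E ∩ A_n) · π(M)`.
  Proof: Kesten's two-sided level decomposition at the annulus `(s m₁, s m₂)` (`top_two_sided_aspect`, p1 gen 3/4: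
  `S_E(N) ≤ P(E ∩ A_N) ≤ S_E(N) + ϰ⁻² α π(N)` with `S_E(N) = Σ_(U,R) w_E(U,R) · γ_N(U,R)`), and on each kernel the obstacle gluing of
  `…ObstacleQuasiMult` (`ϰ γ_M(U,R) π(n) ≤ γ_n(U,R) π(M)`, the explored set `U ⊆ Λ(s m₂)` being the obstacle and its rim `R` the sources).
* **`iicMeasure_real_ge_of_setToSetQuasiMultAspectAt`** — letting `n → ∞`: for every measure `ν` with Kesten's IIC limit property at `p`,
  **`ϰ · P_p(E | A_M) − ϰ⁻¹ · α(s m₁, s m₂) ≤ ν(E)`**.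
* **`iicMeasure_real_ge_criticalProbI`** — at `p_c(ℤ^d)`, `d ≥ 2`, under (A2)□ at aspect `(s,L)` (`2 ≤ s`): for every `m₁ ≥ 1` and `ε > 0` there
  is an explicit radius `M` with **`ϰ · P_{p_c}(E | 0 ↔ ∂ⁱⁿΛ(M)) − ε ≤ ν(E)` for every IIC measure `ν` and every `E ∈ σ(Λ(s m₁))`** (`α(a,b) → 0` as
  `b → ∞` because `θ(p_c) = 0`); **`iicMeasure_real_ge_Z2`** — the same on `ℤ²`, unconditionally ((A2)□(9,77) from RSW, p1 gen 6).
  HONEST LABEL: for a single `E` (indeed uniformly on the finite algebra `σ(Λ(s m₁))`) the qualitative `ε`-form also follows from the IIC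
  limit `P(E | A_M) → ν(E)` itself; the content of this file is the QUANTITATIVE form of §1–§2 — the explicit radius `M = s(L m₂ + 2)` and the
  explicit error `ϰ⁻¹ α_p(s m₁, s m₂)` (the one-arm decay from the scale of `E` to the scale of the conditioning), uniform in `E` and `ν`, at every `p`
  where (A2)□ holds — Kesten's (2.22)-type two-sided control in the Basu–Sapozhnikov generality.

With gen 7's upper bound this says: ON EVERY BOX, KESTEN'S IIC AND CRITICAL PERCOLATION CONDITIONED ON ONE LONG ARM ARE MUTUALLY
COMPARABLE — `ϰ P(E | A_M) − ε ≤ ν(E) ≤ C P(E | A_M)` on `σ(Λ(a))` for `M = M(a, ε)` — so in particular `P(E | A_M) ≤ ϰ⁻¹(ν(E) + ε)`: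
events that are rare for the IIC are uniformly rare for the arm-conditioned measures at all large scales.
References: H. Kesten, *The incipient infinite cluster in two-dimensional percolation*, PTRF 73 (1986), §2 (2.16)–(2.22); D. Basu,
A. Sapozhnikov, ECP 22 (2017) no. 26, §2 (2.5)–(2.8); G. Grimmett, *Percolation* (2nd ed. 1999), §2.3 Thm (2.12).
-/

noncomputable section

namespace Summit.CriticalPhenomena.PercolationContinuityZ3.Theorems.Crossing

open MeasureTheory Filter Topology Literature.Probability.Percolation Literature.Probability.LatticeModels
open Literature.Probability.Percolation.DCT16
open Summit.CriticalPhenomena.PercolationContinuityZ3.Theorems.SurfaceTension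
open scoped Literature.Probability.Percolation

variable {d : ℕ}

/-! ## §1 The finite-volume inequality -/

/-- **Lower domination at finite volume.**  (A2)□ at aspect `(s, L)` (`2 ≤ s < L`, `ϰ > 0`), `E` determined by pairs of `Λ(s m₁)`,
`m₁ ≥ 1`, `L m₁ < s m₂`, `M = s (L m₂ + 2)`, `n > L (L m₂ + 2)`:
`ϰ · π_p(n) · (P_p(E ∩ A_M) − ϰ⁻² α_p(s m₁, s m₂) π_p(M)) ≤ P_p(E ∩ A_n) · π_p(M)` — the two-sided level decomposition of the IIC scheme at
the annulus `(s m₁, s m₂)` for the radii `M` and `n`, compared kernel by kernel through the obstacle gluing.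
[cite: Kesten1986, §2 eq. (2.22)] [cite: BasuSapozhnikov2017ECP, §2 (2.5)–(2.8)] -/
theorem mul_real_inter_siteToBoundary_le_of_setToSetQuasiMultAspectAt (p : unitInterval) {s L : ℕ} (hs : 2 ≤ s) (hsL : s < L)
    {ϰ : ℝ} (hϰ : 0 < ϰ) (hA2 : SetToSetQuasiMultAspectAt d p s L ϰ) {m₁ m₂ n : ℕ} (hm₁ : 1 ≤ m₁) (h12 : L * m₁ < s * m₂)
    (hn : L * (L * m₂ + 2) < n) {E : Set (BondConfig (Site d))} {F : Finset (Sym2 (Site d))} (hE : DeterminedBy E ↑F)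
    (hF : F ⊆ (box d (s * m₁)).sym2) :
    ϰ * oneArmProb d p n * ((bondPercolation (zdGraph d) p).real (E ∩ siteToBoundary d (s * (L * m₂ + 2))) -
        ϰ⁻¹ ^ 2 * (bondPercolation (zdGraph d) p).real (boxCrossing d (s * m₁) (s * m₂)) * oneArmProb d p (s * (L * m₂ + 2))) ≤
      (bondPercolation (zdGraph d) p).real (E ∩ siteToBoundary d n) * oneArmProb d p (s * (L * m₂ + 2)) := by
  classical
  set μ := bondPercolation (zdGraph d) p with hμ
  -- scales
  have hm₁₂ : m₁ ≤ m₂ := by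
    have h1 : s * m₁ ≤ L * m₁ := Nat.mul_le_mul_right m₁ hsL.le
    exact (Nat.lt_of_mul_lt_mul_left (lt_of_le_of_lt h1 h12)).le
  have hM : L * m₂ < s * (L * m₂ + 2) := by
    have h2 : 2 * (L * m₂ + 2) ≤ s * (L * m₂ + 2) := Nat.mul_le_mul_right _ hs
    omega
  have hnL : L * m₂ < n := by nlinarith
  have hsn : s * (L * m₂ + 2) < n := lt_of_lt_of_le (Nat.mul_lt_mul_of_pos_right hsL (by omega)) hn.le
  -- (A2)□ in the `σ/τ` form of the scheme files
  have hσ : ∀ m : ℕ, 1 ≤ m → m < (fun m => s * m) m := fun m hm => by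
    show m < s * m; nlinarith
  have hστ : ∀ m : ℕ, 1 ≤ m → (fun m => s * m) m < (fun m => L * m) m := fun m hm => by
    show s * m < L * m; exact Nat.mul_lt_mul_of_pos_right hsL (by omega)
  -- the two-sided decomposition at radius `M` (upper) and at radius `n` (lower)
  obtain ⟨-, hupM⟩ := top_two_sided_aspect p hϰ (σ := fun m => s * m) (τ := fun m => L * m) hσ hστ
    (fun m hm Z hZ X hX Y hY => by rw [mul_assoc]; exact hA2 m hm Z hZ X hX Y hY) hm₁ hm₁₂ h12 hM hE hF
  obtain ⟨hlown, -⟩ := top_two_sided_aspect p hϰ (σ := fun m => s * m) (τ := fun m => L * m) hσ hστ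
    (fun m hm Z hZ X hX Y hY => by rw [mul_assoc]; exact hA2 m hm Z hZ X hX Y hY) hm₁ hm₁₂ h12 hnL hE hF
  -- kernel by kernel: the obstacle gluing
  have hterm : ∀ C ∈ ((box d (s * m₂)).powerset.filter (fun U => box d (s * m₁) ⊆ U)) ×ˢ (box d (s * m₂ + 1)).powerset,
      ϰ * oneArmProb d p n *
          ((bondPercolation (zdGraph d) p).real (E ∩
          {ω : BondConfig (Site d) | ω ∩ (↑((box d (s * m₂ + 1)).sym2) : Set (Sym2 (Site d))) ∈
            explEvent (↑(box d (s * m₁)) : Set (Site d)) ((↑(box d (s * m₂)) : Set (Site d)) \ ↑(box d (s * m₁))) ↑C.1 ↑C.2} ∩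
          {ω : BondConfig (Site d) | ∀ r ∈ C.2, ∀ r' ∈ C.2, ∃ v ∈ C.1, ∃ v' ∈ C.1,
            s(v, r) ∈ ω ∧ s(v', r') ∈ ω ∧ ω ∈ openConnIn ((↑C.1 : Set (Site d)) \ ↑(box d (s * m₁ - 1))) v v'} ∩
          {ω : BondConfig (Site d) | ∃ x ∈ ({0} : Finset (Site d)), ∃ r ∈ C.2, ∃ v ∈ C.1, ω ∈ openConnIn ((↑C.1 : Set (Site d)) \ ↑(∅ : Finset (Site d))) x v ∧ s(v, r) ∈ ω}) *
        (bondPercolation (zdGraph d) p).real {ω : BondConfig (Site d) | ∃ x ∈ C.2, ∃ t ∈ innerBoundary (zdGraph d) (box d (s * (L * m₂ + 2))),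
            ω ∈ openConnIn ((↑(box d (s * (L * m₂ + 2))) : Set (Site d)) \ ↑C.1) x t}) ≤
        (bondPercolation (zdGraph d) p).real (E ∩
          {ω : BondConfig (Site d) | ω ∩ (↑((box d (s * m₂ + 1)).sym2) : Set (Sym2 (Site d))) ∈
            explEvent (↑(box d (s * m₁)) : Set (Site d)) ((↑(box d (s * m₂)) : Set (Site d)) \ ↑(box d (s * m₁))) ↑C.1 ↑C.2} ∩
          {ω : BondConfig (Site d) | ∀ r ∈ C.2, ∀ r' ∈ C.2, ∃ v ∈ C.1, ∃ v' ∈ C.1,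
            s(v, r) ∈ ω ∧ s(v', r') ∈ ω ∧ ω ∈ openConnIn ((↑C.1 : Set (Site d)) \ ↑(box d (s * m₁ - 1))) v v'} ∩
          {ω : BondConfig (Site d) | ∃ x ∈ ({0} : Finset (Site d)), ∃ r ∈ C.2, ∃ v ∈ C.1, ω ∈ openConnIn ((↑C.1 : Set (Site d)) \ ↑(∅ : Finset (Site d))) x v ∧ s(v, r) ∈ ω}) *
        (bondPercolation (zdGraph d) p).real {ω : BondConfig (Site d) | ∃ x ∈ C.2, ∃ t ∈ innerBoundary (zdGraph d) (box d n),
            ω ∈ openConnIn ((↑(box d n) : Set (Site d)) \ ↑C.1) x t} * oneArmProb d p (s * (L * m₂ + 2)) := by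
    intro C hC
    obtain ⟨hC1, hC2⟩ := Finset.mem_product.1 hC
    have hU : C.1 ⊆ box d (L * m₂ + 2 - 1) := by
      have h1 : C.1 ⊆ box d (s * m₂) := Finset.mem_powerset.1 (Finset.mem_filter.1 hC1).1
      have h2 : s * m₂ ≤ L * m₂ := Nat.mul_le_mul_right m₂ hsL.le
      exact h1.trans (box_mono d (by omega))
    have hR : C.2 ⊆ box d (L * m₂ + 2) :=
      (Finset.mem_powerset.1 hC2).trans (box_mono d (by
        have h2 : s * m₂ ≤ L * m₂ := Nat.mul_le_mul_right m₂ hsL.le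
        omega))
    have hkey := mul_real_link_sdiff_oneArmProb_le_of_setToSetQuasiMultAspectAt p (by omega : 1 ≤ s) hϰ.le hA2
      (m := L * m₂ + 2) (n := n) (by omega) hn hsn hU hR
    have hw : 0 ≤ (bondPercolation (zdGraph d) p).real (E ∩
          {ω : BondConfig (Site d) | ω ∩ (↑((box d (s * m₂ + 1)).sym2) : Set (Sym2 (Site d))) ∈
            explEvent (↑(box d (s * m₁)) : Set (Site d)) ((↑(box d (s * m₂)) : Set (Site d)) \ ↑(box d (s * m₁))) ↑C.1 ↑C.2} ∩
          {ω : BondConfig (Site d) | ∀ r ∈ C.2, ∀ r' ∈ C.2, ∃ v ∈ C.1, ∃ v' ∈ C.1,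
            s(v, r) ∈ ω ∧ s(v', r') ∈ ω ∧ ω ∈ openConnIn ((↑C.1 : Set (Site d)) \ ↑(box d (s * m₁ - 1))) v v'} ∩
          {ω : BondConfig (Site d) | ∃ x ∈ ({0} : Finset (Site d)), ∃ r ∈ C.2, ∃ v ∈ C.1, ω ∈ openConnIn ((↑C.1 : Set (Site d)) \ ↑(∅ : Finset (Site d))) x v ∧ s(v, r) ∈ ω}) := measureReal_nonneg
    calc ϰ * oneArmProb d p n * (_ * _) = _ * (ϰ * (bondPercolation (zdGraph d) p).real {ω : BondConfig (Site d) | ∃ x ∈ C.2, ∃ t ∈ innerBoundary (zdGraph d) (box d (s * (L * m₂ + 2))),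
            ω ∈ openConnIn ((↑(box d (s * (L * m₂ + 2))) : Set (Site d)) \ ↑C.1) x t} * oneArmProb d p n) := by ring
      _ ≤ _ * ((bondPercolation (zdGraph d) p).real {ω : BondConfig (Site d) | ∃ x ∈ C.2, ∃ t ∈ innerBoundary (zdGraph d) (box d n),
            ω ∈ openConnIn ((↑(box d n) : Set (Site d)) \ ↑C.1) x t} * oneArmProb d p (s * (L * m₂ + 2))) := mul_le_mul_of_nonneg_left hkey hw
      _ = _ := by ring
  -- sum the kernel inequalities
  have hsum : ϰ * oneArmProb d p n *
      (∑ C ∈ ((box d (s * m₂)).powerset.filter (fun U => box d (s * m₁) ⊆ U)) ×ˢ (box d (s * m₂ + 1)).powerset,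
        (bondPercolation (zdGraph d) p).real (E ∩
          {ω : BondConfig (Site d) | ω ∩ (↑((box d (s * m₂ + 1)).sym2) : Set (Sym2 (Site d))) ∈
            explEvent (↑(box d (s * m₁)) : Set (Site d)) ((↑(box d (s * m₂)) : Set (Site d)) \ ↑(box d (s * m₁))) ↑C.1 ↑C.2} ∩
          {ω : BondConfig (Site d) | ∀ r ∈ C.2, ∀ r' ∈ C.2, ∃ v ∈ C.1, ∃ v' ∈ C.1,
            s(v, r) ∈ ω ∧ s(v', r') ∈ ω ∧ ω ∈ openConnIn ((↑C.1 : Set (Site d)) \ ↑(box d (s * m₁ - 1))) v v'} ∩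
          {ω : BondConfig (Site d) | ∃ x ∈ ({0} : Finset (Site d)), ∃ r ∈ C.2, ∃ v ∈ C.1, ω ∈ openConnIn ((↑C.1 : Set (Site d)) \ ↑(∅ : Finset (Site d))) x v ∧ s(v, r) ∈ ω}) *
        (bondPercolation (zdGraph d) p).real {ω : BondConfig (Site d) | ∃ x ∈ C.2, ∃ t ∈ innerBoundary (zdGraph d) (box d (s * (L * m₂ + 2))),
            ω ∈ openConnIn ((↑(box d (s * (L * m₂ + 2))) : Set (Site d)) \ ↑C.1) x t}) ≤
      (∑ C ∈ ((box d (s * m₂)).powerset.filter (fun U => box d (s * m₁) ⊆ U)) ×ˢ (box d (s * m₂ + 1)).powerset,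
        (bondPercolation (zdGraph d) p).real (E ∩
          {ω : BondConfig (Site d) | ω ∩ (↑((box d (s * m₂ + 1)).sym2) : Set (Sym2 (Site d))) ∈
            explEvent (↑(box d (s * m₁)) : Set (Site d)) ((↑(box d (s * m₂)) : Set (Site d)) \ ↑(box d (s * m₁))) ↑C.1 ↑C.2} ∩
          {ω : BondConfig (Site d) | ∀ r ∈ C.2, ∀ r' ∈ C.2, ∃ v ∈ C.1, ∃ v' ∈ C.1,
            s(v, r) ∈ ω ∧ s(v', r') ∈ ω ∧ ω ∈ openConnIn ((↑C.1 : Set (Site d)) \ ↑(box d (s * m₁ - 1))) v v'} ∩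
          {ω : BondConfig (Site d) | ∃ x ∈ ({0} : Finset (Site d)), ∃ r ∈ C.2, ∃ v ∈ C.1, ω ∈ openConnIn ((↑C.1 : Set (Site d)) \ ↑(∅ : Finset (Site d))) x v ∧ s(v, r) ∈ ω}) *
        (bondPercolation (zdGraph d) p).real {ω : BondConfig (Site d) | ∃ x ∈ C.2, ∃ t ∈ innerBoundary (zdGraph d) (box d n),
            ω ∈ openConnIn ((↑(box d n) : Set (Site d)) \ ↑C.1) x t}) * oneArmProb d p (s * (L * m₂ + 2)) := by
    rw [Finset.mul_sum, Finset.sum_mul]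
    exact Finset.sum_le_sum hterm
  -- assemble
  have hπn : 0 ≤ ϰ * oneArmProb d p n := mul_nonneg hϰ.le measureReal_nonneg
  have hπM : 0 ≤ oneArmProb d p (s * (L * m₂ + 2)) := measureReal_nonneg
  calc ϰ * oneArmProb d p n * (μ.real (E ∩ siteToBoundary d (s * (L * m₂ + 2))) -
        ϰ⁻¹ ^ 2 * μ.real (boxCrossing d (s * m₁) (s * m₂)) * oneArmProb d p (s * (L * m₂ + 2)))
      ≤ ϰ * oneArmProb d p n *
          (∑ C ∈ ((box d (s * m₂)).powerset.filter (fun U => box d (s * m₁) ⊆ U)) ×ˢ (box d (s * m₂ + 1)).powerset,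
        (bondPercolation (zdGraph d) p).real (E ∩
          {ω : BondConfig (Site d) | ω ∩ (↑((box d (s * m₂ + 1)).sym2) : Set (Sym2 (Site d))) ∈
            explEvent (↑(box d (s * m₁)) : Set (Site d)) ((↑(box d (s * m₂)) : Set (Site d)) \ ↑(box d (s * m₁))) ↑C.1 ↑C.2} ∩
          {ω : BondConfig (Site d) | ∀ r ∈ C.2, ∀ r' ∈ C.2, ∃ v ∈ C.1, ∃ v' ∈ C.1,
            s(v, r) ∈ ω ∧ s(v', r') ∈ ω ∧ ω ∈ openConnIn ((↑C.1 : Set (Site d)) \ ↑(box d (s * m₁ - 1))) v v'} ∩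
          {ω : BondConfig (Site d) | ∃ x ∈ ({0} : Finset (Site d)), ∃ r ∈ C.2, ∃ v ∈ C.1, ω ∈ openConnIn ((↑C.1 : Set (Site d)) \ ↑(∅ : Finset (Site d))) x v ∧ s(v, r) ∈ ω}) *
        (bondPercolation (zdGraph d) p).real {ω : BondConfig (Site d) | ∃ x ∈ C.2, ∃ t ∈ innerBoundary (zdGraph d) (box d (s * (L * m₂ + 2))),
            ω ∈ openConnIn ((↑(box d (s * (L * m₂ + 2))) : Set (Site d)) \ ↑C.1) x t}) :=
        mul_le_mul_of_nonneg_left (by linarith [hupM]) hπn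
    _ ≤ (∑ C ∈ ((box d (s * m₂)).powerset.filter (fun U => box d (s * m₁) ⊆ U)) ×ˢ (box d (s * m₂ + 1)).powerset,
        (bondPercolation (zdGraph d) p).real (E ∩
          {ω : BondConfig (Site d) | ω ∩ (↑((box d (s * m₂ + 1)).sym2) : Set (Sym2 (Site d))) ∈
            explEvent (↑(box d (s * m₁)) : Set (Site d)) ((↑(box d (s * m₂)) : Set (Site d)) \ ↑(box d (s * m₁))) ↑C.1 ↑C.2} ∩
          {ω : BondConfig (Site d) | ∀ r ∈ C.2, ∀ r' ∈ C.2, ∃ v ∈ C.1, ∃ v' ∈ C.1,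
            s(v, r) ∈ ω ∧ s(v', r') ∈ ω ∧ ω ∈ openConnIn ((↑C.1 : Set (Site d)) \ ↑(box d (s * m₁ - 1))) v v'} ∩
          {ω : BondConfig (Site d) | ∃ x ∈ ({0} : Finset (Site d)), ∃ r ∈ C.2, ∃ v ∈ C.1, ω ∈ openConnIn ((↑C.1 : Set (Site d)) \ ↑(∅ : Finset (Site d))) x v ∧ s(v, r) ∈ ω}) *
        (bondPercolation (zdGraph d) p).real {ω : BondConfig (Site d) | ∃ x ∈ C.2, ∃ t ∈ innerBoundary (zdGraph d) (box d n),
            ω ∈ openConnIn ((↑(box d n) : Set (Site d)) \ ↑C.1) x t}) * oneArmProb d p (s * (L * m₂ + 2)) := hsum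
    _ ≤ μ.real (E ∩ siteToBoundary d n) * oneArmProb d p (s * (L * m₂ + 2)) := mul_le_mul_of_nonneg_right hlown hπM

/-! ## §2 The IIC form -/

/-- **Lower domination of the IIC by arm-conditioned percolation.**  Under (A2)□ at aspect `(s, L)` (`2 ≤ s < L`, `ϰ > 0`, `0 < p`,
`d ≥ 1`), for every measure `ν` with Kesten's IIC limit property at `p`, every `E` determined by pairs of `Λ(s m₁)` (`m₁ ≥ 1`) and
every `m₂` with `L m₁ < s m₂`:  **`ϰ · P_p(E ∩ A_M)/π_p(M) − ϰ⁻¹ · α_p(s m₁, s m₂) ≤ ν(E)`**, `M = s(L m₂ + 2)`.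
[cite: Kesten1986, §2 eq. (2.22)] [cite: BasuSapozhnikov2017ECP, Thm. 1.1 and §2 (2.5)] -/
theorem iicMeasure_real_ge_of_setToSetQuasiMultAspectAt (hd : 1 ≤ d) (p : unitInterval) (hp : 0 < (p : ℝ)) {s L : ℕ}
    (hs : 2 ≤ s) (hsL : s < L) {ϰ : ℝ} (hϰ : 0 < ϰ) (hA2 : SetToSetQuasiMultAspectAt d p s L ϰ)
    {ν : Measure (BondConfig (Site d))}
    (hν : ∀ (F : Finset (Sym2 (Site d))) (E : Set (BondConfig (Site d))), MeasurableSet E → DeterminedBy E ↑F →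
      Tendsto (fun n : ℕ => (bondPercolation (zdGraph d) p).real (E ∩ siteToBoundary d n) / oneArmProb d p n)
        atTop (𝓝 (ν.real E)))
    {m₁ m₂ : ℕ} (hm₁ : 1 ≤ m₁) (h12 : L * m₁ < s * m₂)
    {E : Set (BondConfig (Site d))} {F : Finset (Sym2 (Site d))} (hE : DeterminedBy E ↑F) (hF : F ⊆ (box d (s * m₁)).sym2) :
    ϰ * ((bondPercolation (zdGraph d) p).real (E ∩ siteToBoundary d (s * (L * m₂ + 2))) / oneArmProb d p (s * (L * m₂ + 2))) -
        ϰ⁻¹ * (bondPercolation (zdGraph d) p).real (boxCrossing d (s * m₁) (s * m₂)) ≤ ν.real E := by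
  have hπ : ∀ m, 0 < oneArmProb d p m := oneArmProb_pos hd p hp
  set μ := bondPercolation (zdGraph d) p with hμ
  set M := s * (L * m₂ + 2) with hMdef
  refine ge_of_tendsto (hν F E (hE.measurableSet_of_finset) hE) ?_
  filter_upwards [eventually_gt_atTop (L * (L * m₂ + 2))] with n hn
  have h := mul_real_inter_siteToBoundary_le_of_setToSetQuasiMultAspectAt p hs hsL hϰ hA2 hm₁ h12 hn hE hF
  rw [le_div_iff₀ (hπ n)]
  have hϰne : ϰ ≠ 0 := hϰ.ne'
  -- divide the finite-volume inequality by `π(M) > 0`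
  have hPM : μ.real (E ∩ siteToBoundary d M) / oneArmProb d p M * oneArmProb d p M = μ.real (E ∩ siteToBoundary d M) :=
    div_mul_cancel₀ _ (hπ M).ne'
  have heq : (ϰ * (μ.real (E ∩ siteToBoundary d M) / oneArmProb d p M) - ϰ⁻¹ * μ.real (boxCrossing d (s * m₁) (s * m₂))) *
      oneArmProb d p n * oneArmProb d p M =
      ϰ * oneArmProb d p n * (μ.real (E ∩ siteToBoundary d M) -
        ϰ⁻¹ ^ 2 * μ.real (boxCrossing d (s * m₁) (s * m₂)) * oneArmProb d p M) := by
    calc (ϰ * (μ.real (E ∩ siteToBoundary d M) / oneArmProb d p M) - ϰ⁻¹ * μ.real (boxCrossing d (s * m₁) (s * m₂))) *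
          oneArmProb d p n * oneArmProb d p M
        = ϰ * oneArmProb d p n * (μ.real (E ∩ siteToBoundary d M) / oneArmProb d p M * oneArmProb d p M) -
            1 * ϰ⁻¹ * μ.real (boxCrossing d (s * m₁) (s * m₂)) * oneArmProb d p n * oneArmProb d p M := by ring
      _ = ϰ * oneArmProb d p n * μ.real (E ∩ siteToBoundary d M) -
            ϰ * ϰ⁻¹ * ϰ⁻¹ * μ.real (boxCrossing d (s * m₁) (s * m₂)) * oneArmProb d p n * oneArmProb d p M := by
          rw [hPM, mul_inv_cancel₀ hϰne]
      _ = _ := by ring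
  have h' : (ϰ * (μ.real (E ∩ siteToBoundary d M) / oneArmProb d p M) - ϰ⁻¹ * μ.real (boxCrossing d (s * m₁) (s * m₂))) *
      oneArmProb d p n * oneArmProb d p M ≤ μ.real (E ∩ siteToBoundary d n) * oneArmProb d p M := by
    rw [heq]; exact h
  exact le_of_mul_le_mul_right h' (hπ M)

/-- The aspect-`(2,4)` form: under `SetToSetQuasiMultAt d p ϰ`, for `E` determined by pairs of `Λ(2 m₁)` and `2 m₁ < m₂`:
`ϰ · P_p(E | A_{2(4 m₂ + 2)}) − ϰ⁻¹ α_p(2 m₁, 2 m₂) ≤ ν(E)`. [cite: Kesten1986, §2 eq. (2.22)] [cite: BasuSapozhnikov2017ECP, Thm. 1.1] -/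
theorem iicMeasure_real_ge_of_setToSetQuasiMultAt (hd : 1 ≤ d) (p : unitInterval) (hp : 0 < (p : ℝ)) {ϰ : ℝ} (hϰ : 0 < ϰ)
    (hA2 : SetToSetQuasiMultAt d p ϰ) {ν : Measure (BondConfig (Site d))}
    (hν : ∀ (F : Finset (Sym2 (Site d))) (E : Set (BondConfig (Site d))), MeasurableSet E → DeterminedBy E ↑F →
      Tendsto (fun n : ℕ => (bondPercolation (zdGraph d) p).real (E ∩ siteToBoundary d n) / oneArmProb d p n)
        atTop (𝓝 (ν.real E)))
    {m₁ m₂ : ℕ} (hm₁ : 1 ≤ m₁) (h12 : 2 * m₁ < m₂)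
    {E : Set (BondConfig (Site d))} {F : Finset (Sym2 (Site d))} (hE : DeterminedBy E ↑F) (hF : F ⊆ (box d (2 * m₁)).sym2) :
    ϰ * ((bondPercolation (zdGraph d) p).real (E ∩ siteToBoundary d (2 * (4 * m₂ + 2))) / oneArmProb d p (2 * (4 * m₂ + 2))) -
        ϰ⁻¹ * (bondPercolation (zdGraph d) p).real (boxCrossing d (2 * m₁) (2 * m₂)) ≤ ν.real E :=
  iicMeasure_real_ge_of_setToSetQuasiMultAspectAt hd p hp (by norm_num) (by norm_num) hϰ (setToSetQuasiMultAt_iff_aspect.1 hA2) hν hm₁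
    (by omega) hE hF

/-! ## §3 At `p_c(ℤ^d)` and on `ℤ²`: the error term vanishes -/

/-- **Lower domination at `p_c(ℤ^d)`** (`d ≥ 2`, (A2)□ at aspect `(s, L)`, `2 ≤ s`, `ϰ > 0`; `θ(p_c) = 0` from
`CSH.percolationContinuity_allDimensions`): for every `m₁ ≥ 1` and `ε > 0` there is a radius `M` such that for every measure `ν` with
Kesten's IIC limit property at `p_c` and every event `E` determined by the pairs of `Λ(s m₁)`:
**`ϰ · P_{p_c}(E ∩ {0 ↔ ∂ⁱⁿΛ(M)}) / π_{p_c}(M) − ε ≤ ν(E)`**.  With p1 gen 7's `iicMeasure_real_le_mul_cond_criticalProbI` (`ν ≤ C·P(·|A_b)`):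
the IIC and the arm-conditioned critical measures are mutually comparable on every box.
[cite: Kesten1986, §2 eq. (2.22)] [cite: BasuSapozhnikov2017ECP, Thm. 1.1] -/
theorem iicMeasure_real_ge_criticalProbI (hd : 2 ≤ d) {s L : ℕ} (hs : 2 ≤ s) {ϰ : ℝ} (hϰ : 0 < ϰ)
    (hA2 : SetToSetQuasiMultAspectAt d (criticalProbI d) s L ϰ) {m₁ : ℕ} (hm₁ : 1 ≤ m₁) {ε : ℝ} (hε : 0 < ε) :
    ∃ M : ℕ, s * m₁ ≤ M ∧ ∀ (ν : Measure (BondConfig (Site d))),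
      (∀ (F : Finset (Sym2 (Site d))) (E : Set (BondConfig (Site d))), MeasurableSet E → DeterminedBy E ↑F →
        Tendsto (fun n : ℕ => (bondPercolation (zdGraph d) (criticalProbI d)).real (E ∩ siteToBoundary d n) /
          oneArmProb d (criticalProbI d) n) atTop (𝓝 (ν.real E))) →
      ∀ (E : Set (BondConfig (Site d))), DeterminedBy E (↑((box d (s * m₁)).sym2) : Set (Sym2 (Site d))) →
        ϰ * ((bondPercolation (zdGraph d) (criticalProbI d)).real (E ∩ siteToBoundary d M) / oneArmProb d (criticalProbI d) M) - ε ≤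
          ν.real E := by
  have hpc : 0 < ((criticalProbI d : unitInterval) : ℝ) := by
    exact_mod_cast Literature.Barriers.CriticalPhenomena.criticalProbI_pos' (d := d) (by omega)
  -- enlarge the outer aspect so that `s < L'`
  set L' : ℕ := max L (s + 1) with hL'
  have hsL' : s < L' := lt_of_lt_of_le (Nat.lt_succ_self s) (le_max_right _ _)
  have hA2' : SetToSetQuasiMultAspectAt d (criticalProbI d) s L' ϰ := hA2.mono_outer (le_max_left _ _)
  -- `α(s m₁, b) → 0` (θ(p_c) = 0): choose `m₂`
  have hθ : theta (zdGraph d) 0 (criticalProbI d) = 0 := CSH.percolationContinuity_allDimensions d hd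
  have hα := tendsto_real_boxCrossing_of_theta_eq_zero (d := d) (criticalProbI d) hθ (s * m₁)
  have hα' := hα.comp (tendsto_id.const_mul_atTop' (by omega : 0 < s) : Tendsto (fun m : ℕ => s * m) atTop atTop)
  have hev : ∀ᶠ m₂ : ℕ in atTop, (bondPercolation (zdGraph d) (criticalProbI d)).real (boxCrossing d (s * m₁) (s * m₂)) < ϰ * ε := by
    have h := hα'.eventually (gt_mem_nhds (mul_pos hϰ hε))
    simpa only [Function.comp_apply] using h
  obtain ⟨m₂, hm₂α, hm₂⟩ := (hev.and (eventually_gt_atTop (L' * m₁))).exists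
  have hsm₂ : m₂ ≤ s * m₂ := Nat.le_mul_of_pos_left m₂ (by omega)
  have hL'm₁ : m₁ ≤ L' * m₁ := Nat.le_mul_of_pos_left m₁ (by omega)
  have hL'm₂ : m₂ ≤ L' * m₂ := Nat.le_mul_of_pos_left m₂ (by omega)
  have h12 : L' * m₁ < s * m₂ := by omega
  refine ⟨s * (L' * m₂ + 2), ?_, fun ν hν E hE => ?_⟩
  · exact Nat.mul_le_mul_left s (by omega)
  have h := iicMeasure_real_ge_of_setToSetQuasiMultAspectAt (by omega) (criticalProbI d) hpc hs hsL' hϰ hA2' hν hm₁ h12 hE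
    subset_rfl
  have herr : ϰ⁻¹ * (bondPercolation (zdGraph d) (criticalProbI d)).real (boxCrossing d (s * m₁) (s * m₂)) ≤ ε := by
    rw [inv_mul_le_iff₀ hϰ]
    exact hm₂α.le
  linarith

/-- **Lower domination of the planar IIC, unconditionally**: on `ℤ²` at `p_c = 1/2` ((A2)□ at aspect `(9, 77)` from RSW, p1 gen 6) there is
`ϰ > 0` such that for every `m₁ ≥ 1` and `ε > 0` some radius `M` satisfies `ϰ · P_{1/2}(E | 0 ↔ ∂ⁱⁿΛ(M)) − ε ≤ ν(E)` for every measure `ν`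
with Kesten's IIC limit property and every `E ∈ σ(Λ(9 m₁))`. [cite: Kesten1986, §2 eq. (2.22) and Thm. (3)] -/
theorem iicMeasure_real_ge_Z2 :
    ∃ ϰ : ℝ, 0 < ϰ ∧ ∀ (m₁ : ℕ), 1 ≤ m₁ → ∀ (ε : ℝ), 0 < ε →
      ∃ M : ℕ, 9 * m₁ ≤ M ∧ ∀ (ν : Measure (BondConfig (Site 2))),
        (∀ (F : Finset (Sym2 (Site 2))) (E : Set (BondConfig (Site 2))), MeasurableSet E → DeterminedBy E ↑F →
          Tendsto (fun n : ℕ => (bondPercolation (zdGraph 2) (criticalProbI 2)).real (E ∩ siteToBoundary 2 n) /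
            oneArmProb 2 (criticalProbI 2) n) atTop (𝓝 (ν.real E))) →
        ∀ (E : Set (BondConfig (Site 2))), DeterminedBy E (↑((box 2 (9 * m₁)).sym2) : Set (Sym2 (Site 2))) →
          ϰ * ((bondPercolation (zdGraph 2) (criticalProbI 2)).real (E ∩ siteToBoundary 2 M) / oneArmProb 2 (criticalProbI 2) M) - ε ≤
            ν.real E := by
  obtain ⟨ϰ, hϰ, hA2⟩ := exists_setToSetQuasiMultAspectAt_two_of_criticalProbI_le
  exact ⟨ϰ, hϰ, fun m₁ hm₁ ε hε => iicMeasure_real_ge_criticalProbI (d := 2) le_rfl (by norm_num) hϰ (hA2 _ le_rfl) hm₁ hε⟩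

/-- **Two-sided comparability of the IIC with arm-conditioned critical percolation, on every box** (`p_c(ℤ^d)`, `d ≥ 2`, (A2)□ at aspect
`(s, L)` with `2 ≤ s ≤ L`, `ϰ > 0`): there is `C > 0` (p1 gen 7's domination constant) such that for every `m₁ ≥ 1` and `ε > 0` some radius
`M ≥ s m₁` satisfies, for every measure `ν` with Kesten's IIC limit property at `p_c` and every `E ∈ σ(Λ(s m₁))`:
**`ϰ · P_{p_c}(E ∩ A_M)/π_{p_c}(M) − ε ≤ ν(E) ≤ C · P_{p_c}(E ∩ A_M)/π_{p_c}(M)`** — the upper half is `iicMeasure_real_le_mul_cond_criticalProbI`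
(valid at EVERY radius `≥` the scale of `E`), the lower half `iicMeasure_real_ge_criticalProbI`.
[cite: Kesten1986, §2 eq. (2.22)] [cite: BasuSapozhnikov2017ECP, Thm. 1.1] -/
theorem iicMeasure_real_two_sided_criticalProbI (hd : 2 ≤ d) {s L : ℕ} (hs : 2 ≤ s) (hsL : s ≤ L) {ϰ : ℝ} (hϰ : 0 < ϰ)
    (hA2 : SetToSetQuasiMultAspectAt d (criticalProbI d) s L ϰ) :
    ∃ C : ℝ, 0 < C ∧ ∀ (m₁ : ℕ), 1 ≤ m₁ → ∀ (ε : ℝ), 0 < ε →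
      ∃ M : ℕ, s * m₁ ≤ M ∧ ∀ (ν : Measure (BondConfig (Site d))),
        (∀ (F : Finset (Sym2 (Site d))) (E : Set (BondConfig (Site d))), MeasurableSet E → DeterminedBy E ↑F →
          Tendsto (fun n : ℕ => (bondPercolation (zdGraph d) (criticalProbI d)).real (E ∩ siteToBoundary d n) /
            oneArmProb d (criticalProbI d) n) atTop (𝓝 (ν.real E))) →
        ∀ (E : Set (BondConfig (Site d))), DeterminedBy E (↑((box d (s * m₁)).sym2) : Set (Sym2 (Site d))) →
          ϰ * ((bondPercolation (zdGraph d) (criticalProbI d)).real (E ∩ siteToBoundary d M) / oneArmProb d (criticalProbI d) M) - ε ≤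
              ν.real E ∧
            ν.real E ≤ C * ((bondPercolation (zdGraph d) (criticalProbI d)).real (E ∩ siteToBoundary d M) /
              oneArmProb d (criticalProbI d) M) := by
  obtain ⟨C, hC, hup⟩ := iicMeasure_real_le_mul_cond_criticalProbI hd hs hsL hϰ hA2
  refine ⟨C, hC, fun m₁ hm₁ ε hε => ?_⟩
  obtain ⟨M, hM, hlow⟩ := iicMeasure_real_ge_criticalProbI hd hs hϰ hA2 hm₁ hε
  have hsm₁ : m₁ ≤ s * m₁ := Nat.le_mul_of_pos_left m₁ (by omega)
  have hM1 : 1 ≤ M := by omega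
  refine ⟨M, hM, fun ν hν E hE => ⟨hlow ν hν E hE, hup ν hν M hM1 E (hE.mono ?_)⟩⟩
  exact Finset.coe_subset.2 (Finset.sym2_mono (box_mono d hM))

end Summit.CriticalPhenomena.PercolationContinuityZ3.Theorems.Crossing
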